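import Literature.GroupTheory.ArithmeticGroups.SL2Mod8Matrices
import Literature.GroupTheory.ArithmeticGroups.SL2TwoPowCentralExtension
import Literature.GroupTheory.ArithmeticGroups.SL2PrimePowSchurMultiplier
import HarnessLib

/-!
# The base of the `2`-adic descent: central extensions of `SL₂(ℤ/8)`, I (the top layer)

**Theorem (`P(3)`).**  Let `π : E ↠ SL₂(ℤ/8)` be a central extension whose kernel has exponent `2`, and let
`t ∈ E` lift `T̄ = (1 1; 0 1)` with `t⁸ = 1`.  Then `ker π ∩ [E, E] = 1`.

Proof (all in hypothesis form).  Let `l` lift `L̄`, `u = l²`, `e₀ = t⁴`, `f₀ = l⁴`, `h₁ = t f₀ t⁻¹ f₀⁻¹ e₀`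
(lifts of the top layer `1 + 4𝔰𝔩₂`, here `h̄₁ = 5·1`), `d = [t, u]`, `y = [u, d]`, `b = [t², u]` (`ȳ = b̄ = 5·1`).
(1) The top-layer preimage `A` is abelian (`[e₀, f₀] = [t⁴, l²]²`, the commutator `[t⁴, l²]` being central) and,
as `t⁸ = 1`, of exponent `2`.  (2) For `c` over a central scalar, `g ↦ [g, c]` is a homomorphism to the kernel,
so it kills squares and commutators: `[u, y] = [d, y] = [l², b] = [u, δ] = 1` (`δ` a lift of `3·1`).  (3) Hence
`[t⁴, l²] = [t², b] b² = 1`, `[t, y] = 1`, `y = b` (via `T̄ U T̄⁻¹ T̄² = 3·U³ T̄⁴`), `d² = h₁ e₀⁻¹ y ∈ A`, `d⁴ = 1`,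
`t d t⁻¹ = y d³`, `u d u⁻¹ = y d`.  (4) So `D̂ = {dⁱ yʲ}` is normalised by `t, u` and meets `ker π` trivially
(`D̄ⁱ Ȳʲ ≠ 1`).  (5) Transfer to the index-`3` preimage `H` of the Sylow subgroup `⟨T̄, U⟩`: a central
`z ∈ [E, E]` has `z³ ∈ [H, H] ⊆ D̂`, so `z = z³ = 1`.
This is the finite computation behind [CalegariDimitrovTang2025, §4.5, Lemma 4.5.10] (levels `8, 16`, done there
by machine) in the form needed for the `SL₂(ℤ)`-invariant version of Cor. 4.5.3; cf. [Beyl1986].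
-/

open scoped MatrixGroups commutatorElement

universe u

namespace Literature.GroupTheory.ArithmeticGroups

namespace SL2Mod8

open Matrix.SpecialLinearGroup

/-! ### Commutator identities -/

/-- `⁅x, y z⁆ = ⁅x, y⁆ · y ⁅x, z⁆ y⁻¹`. [cite: Rotman1995, Theorem 5.1 (commutator identities)] -/
theorem comm_mul_right {G : Type*} [Group G] (x y z : G) : ⁅x, y * z⁆ = ⁅x, y⁆ * (y * ⁅x, z⁆ * y⁻¹) := by
  simp only [commutatorElement_def]; group

/-- `⁅x y, z⁆ = x ⁅y, z⁆ x⁻¹ · ⁅x, z⁆`. [cite: Rotman1995, Theorem 5.1 (commutator identities)] -/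
theorem comm_mul_left {G : Type*} [Group G] (x y z : G) : ⁅x * y, z⁆ = x * ⁅y, z⁆ * x⁻¹ * ⁅x, z⁆ := by
  simp only [commutatorElement_def]; group

/-- If all commutators with `c` are central, `g ↦ ⁅g, c⁆` is multiplicative. [cite: Rotman1995, Theorem 5.1
(commutator identities)] -/
theorem comm_mul_left_of_central {G : Type*} [Group G] {c : G} (hc : ∀ g h : G, h * ⁅g, c⁆ = ⁅g, c⁆ * h)
    (g h : G) : ⁅g * h, c⁆ = ⁅g, c⁆ * ⁅h, c⁆ := by
  rw [comm_mul_left, hc h g, mul_inv_cancel_right]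
  exact hc g ⁅h, c⁆

/-- Under the same hypothesis `⁅g², c⁆ = ⁅g, c⁆²` and `⁅g⁻¹, c⁆ = ⁅g, c⁆⁻¹`. [cite: Rotman1995, Theorem 5.1
(commutator identities)] -/
theorem comm_inv_left_of_central {G : Type*} [Group G] {c : G} (hc : ∀ g h : G, h * ⁅g, c⁆ = ⁅g, c⁆ * h)
    (g : G) : ⁅g⁻¹, c⁆ = ⁅g, c⁆⁻¹ := by
  have h1 : ⁅g⁻¹ * g, c⁆ = ⁅g⁻¹, c⁆ * ⁅g, c⁆ := comm_mul_left_of_central hc g⁻¹ g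
  rw [inv_mul_cancel, commutatorElement_one_left] at h1
  rw [eq_inv_iff_mul_eq_one, ← h1]

/-- A multiplicative map to elements of order `≤ 2` kills commutators: `⁅⁅a, b⁆, c⁆ = 1`. [cite: Rotman1995,
Theorem 5.1 (commutator identities)] -/
theorem comm_comm_eq_one_of_central {G : Type*} [Group G] {c : G} (hc : ∀ g h : G, h * ⁅g, c⁆ = ⁅g, c⁆ * h)
    (a b : G) : ⁅⁅a, b⁆, c⁆ = 1 := by
  rw [commutatorElement_def a b, comm_mul_left_of_central hc, comm_mul_left_of_central hc,
    comm_mul_left_of_central hc, comm_inv_left_of_central hc, comm_inv_left_of_central hc]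
  have h1 := hc a ⁅b, c⁆
  have h2 := hc b ⁅a, c⁆⁻¹
  have h3 := hc a ⁅b, c⁆⁻¹
  -- everything here commutes: the values `⁅·, c⁆` are central
  calc ⁅a, c⁆ * ⁅b, c⁆ * ⁅a, c⁆⁻¹ * ⁅b, c⁆⁻¹
      = ⁅a, c⁆ * (⁅b, c⁆ * ⁅a, c⁆⁻¹) * ⁅b, c⁆⁻¹ := by group
    _ = ⁅a, c⁆ * (⁅a, c⁆⁻¹ * ⁅b, c⁆) * ⁅b, c⁆⁻¹ := by rw [hc b ⁅a, c⁆⁻¹]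
    _ = 1 := by group

variable {E : Type u} [Group E] {π : E →* SL(2, ZMod (2 ^ 3))}

/-- For `c ∈ E` over a central element of `SL₂(ℤ/8)`, the commutators `⁅g, c⁆` lie in the (central) kernel.
[cite: Beyl1986, Theorem (Schur multiplier of SL(2,ℤ/m)), 2-primary part] -/
theorem comm_central_of_map_central (hcen : ∀ z : E, π z = 1 → ∀ g : E, g * z = z * g) {c : E}
    (hc : ∀ g : SL(2, ZMod (2 ^ 3)), g * π c = π c * g) (g h : E) : h * ⁅g, c⁆ = ⁅g, c⁆ * h := by
  refine hcen _ ?_ h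
  rw [map_commutatorElement, commutatorElement_eq_one_iff_mul_comm]
  exact hc (π g)

section levelEight

variable (hcen : ∀ z : E, π z = 1 → ∀ g : E, g * z = z * g) (hK2 : ∀ z : E, π z = 1 → z ^ 2 = 1)
variable {t l e₀ f₀ h₁ : E} (he₀ : e₀ = t ^ 2 ^ (3 - 1)) (hf₀ : f₀ = l ^ 2 ^ (3 - 1))
  (hh₁ : h₁ = t * f₀ * t⁻¹ * f₀⁻¹ * e₀)
  (ht : ((π t : SL(2, ZMod (2 ^ 3))) : Matrix (Fin 2) (Fin 2) (ZMod (2 ^ 3))) = !![1, 1; 0, 1])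
  (hl : ((π l : SL(2, ZMod (2 ^ 3))) : Matrix (Fin 2) (Fin 2) (ZMod (2 ^ 3))) = !![1, 0; 1, 1])
  (hτ : t ^ 2 ^ 3 = 1)

include he₀ in
/-- `e₀ = t⁴`. [cite: CalegariDimitrovTang2025, §4.5, Lemma 4.5.10] -/
theorem e₀_eq : e₀ = t ^ 4 := by rw [he₀]; norm_num

include hf₀ in
/-- `f₀ = (l²)²`. [cite: CalegariDimitrovTang2025, §4.5, Lemma 4.5.10] -/
theorem f₀_eq : f₀ = (l ^ 2) ^ 2 := by rw [hf₀, ← pow_mul]; norm_num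

include hcen ht hl he₀ in
/-- `c₀ := ⁅e₀, l²⁆ = ⁅t⁴, l²⁆` is central. [cite: Beyl1986, Theorem (Schur multiplier of SL(2,ℤ/m)), 2-primary
part] -/
theorem comm_e₀_u_central (g : E) : g * ⁅e₀, l ^ 2⁆ = ⁅e₀, l ^ 2⁆ * g := by
  refine hcen _ ?_ g
  rw [map_commutatorElement, e₀_eq he₀, map_pow, map_pow]
  exact comm_T4_L2 (π t) (π l) ht hl

include hcen hK2 ht hl he₀ hf₀ in
/-- **`e₀` and `f₀` commute**: `⁅t⁴, l⁴⁆ = ⁅t⁴, l²⁆² = 1`. [cite: Beyl1986, Theorem (Schur multiplier of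
SL(2,ℤ/m)), 2-primary part] -/
theorem commute_e₀_f₀ : Commute e₀ f₀ := by
  have hc := comm_e₀_u_central hcen he₀ ht hl
  have hπc : π ⁅e₀, l ^ 2⁆ = 1 := by
    rw [map_commutatorElement, e₀_eq he₀, map_pow, map_pow]; exact comm_T4_L2 (π t) (π l) ht hl
  rw [← commutatorElement_eq_one_iff_commute, f₀_eq hf₀,
    SL2TwoPowCentralExtension.commutatorElement_pow_right hc, hK2 _ hπc]

include hcen hK2 he₀ hf₀ hh₁ ht hl in
/-- **The top-layer preimage `A` is abelian.** [cite: Beyl1986, Theorem (Schur multiplier of SL(2,ℤ/m)), 2-primary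
part] -/
theorem comm_of_layer {x x' : E}
    (hx : Matrix.SpecialLinearGroup.map (ZMod.castHom (pow_dvd_pow 2 (Nat.sub_le 3 1)) (ZMod (2 ^ (3 - 1))))
      (π x) = 1)
    (hx' : Matrix.SpecialLinearGroup.map (ZMod.castHom (pow_dvd_pow 2 (Nat.sub_le 3 1)) (ZMod (2 ^ (3 - 1))))
      (π x') = 1) : x * x' = x' * x := by
  haveI : Fact (Nat.Prime 2) := ⟨Nat.prime_two⟩
  have he : 2 ≤ 3 := by norm_num
  obtain ⟨a, b, c, z, hz, rfl⟩ := SL2CentralExtension.exists_decomp he₀ hf₀ hh₁ ht hl he hx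
  obtain ⟨a', b', c', z', hz', rfl⟩ := SL2CentralExtension.exists_decomp he₀ hf₀ hh₁ ht hl he hx'
  have heh := SL2CentralExtension.commute_e₀_h₁ hcen he₀ hf₀ hh₁ ht hl he
  have hfh := SL2CentralExtension.commute_f₀_h₁ hcen he₀ hf₀ hh₁ ht hl he
  have hef := commute_e₀_f₀ hcen hK2 he₀ hf₀ ht hl
  have hgen : ∀ {v : E}, (v = e₀ ∨ v = h₁ ∨ v = f₀) → Commute v (e₀ ^ b' * h₁ ^ a' * f₀ ^ c' * z') := by
    intro v hv
    have hvz : Commute v z' := (hcen z' hz' v)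
    rcases hv with rfl | rfl | rfl
    · exact ((((Commute.refl v).pow_right _).mul_right (heh.pow_right _)).mul_right (hef.pow_right _)).mul_right hvz
    · exact (((heh.symm.pow_right _).mul_right ((Commute.refl v).pow_right _)).mul_right
        (hfh.symm.pow_right _)).mul_right hvz
    · exact (((hef.symm.pow_right _).mul_right (hfh.pow_right _)).mul_right
        ((Commute.refl v).pow_right _)).mul_right hvz
  have hzc : Commute z (e₀ ^ b' * h₁ ^ a' * f₀ ^ c' * z') := (hcen z hz _).symm
  exact ((((hgen (Or.inl rfl)).pow_left b).mul_left ((hgen (Or.inr (Or.inl rfl))).pow_left a)).mul_left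
    ((hgen (Or.inr (Or.inr rfl))).pow_left c)).mul_left hzc |>.eq

include hcen hK2 he₀ hf₀ hh₁ ht hl hτ in
/-- **With `t⁸ = 1` the top-layer preimage has exponent `2`.** [cite: Beyl1986, Theorem (Schur multiplier of
SL(2,ℤ/m)), 2-primary part] -/
theorem sq_eq_one_of_layer {x : E}
    (hx : Matrix.SpecialLinearGroup.map (ZMod.castHom (pow_dvd_pow 2 (Nat.sub_le 3 1)) (ZMod (2 ^ (3 - 1))))
      (π x) = 1) : x * x = 1 := by
  haveI : Fact (Nat.Prime 2) := ⟨Nat.prime_two⟩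
  have he : 2 ≤ 3 := by norm_num
  have heh := SL2CentralExtension.commute_e₀_h₁ hcen he₀ hf₀ hh₁ ht hl he
  have hfh := SL2CentralExtension.commute_f₀_h₁ hcen he₀ hf₀ hh₁ ht hl he
  have hef := commute_e₀_f₀ hcen hK2 he₀ hf₀ ht hl
  -- squares of the generators
  have he2 : e₀ * e₀ = 1 := by rw [e₀_eq he₀, ← pow_add]; exact hτ
  have hf2 : f₀ * f₀ = 1 := by
    rw [hf₀, ← pow_two, ← pow_mul, show 2 ^ (3 - 1) * 2 = 2 ^ 3 by norm_num,
      SL2TwoPowCentralExtension.lpow_eq_tau_inv hcen hK2 ht hl (by norm_num : 1 ≤ 3), hτ, inv_one]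
  have hA : ∀ v : E, Matrix.SpecialLinearGroup.map (ZMod.castHom (pow_dvd_pow 2 (Nat.sub_le 3 1))
      (ZMod (2 ^ (3 - 1)))) (π v) = 1 → ∀ w : E, Matrix.SpecialLinearGroup.map
      (ZMod.castHom (pow_dvd_pow 2 (Nat.sub_le 3 1)) (ZMod (2 ^ (3 - 1)))) (π w) = 1 → v * w = w * v :=
    fun v hv w hw ↦ comm_of_layer hcen hK2 he₀ hf₀ hh₁ ht hl hv hw
  have hlay_e := SL2CentralExtension.layer_e₀ (π := π) he₀ ht
  have hlay_f := SL2CentralExtension.layer_f₀ (π := π) hf₀ hl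
  have hlay_x : Matrix.SpecialLinearGroup.map (ZMod.castHom (pow_dvd_pow 2 (Nat.sub_le 3 1))
      (ZMod (2 ^ (3 - 1)))) (π (t * f₀ * t⁻¹)) = 1 := by
    rw [map_mul, map_mul, map_mul, map_mul, hlay_f, mul_one, map_inv, map_inv, mul_inv_cancel]
  have hh2 : h₁ * h₁ = 1 := by
    have hx2 : (t * f₀ * t⁻¹) * (t * f₀ * t⁻¹) = 1 := by
      rw [show (t * f₀ * t⁻¹) * (t * f₀ * t⁻¹) = t * (f₀ * f₀) * t⁻¹ by group, hf2]; group
    have h1 : h₁ = (t * f₀ * t⁻¹) * f₀⁻¹ * e₀ := by rw [hh₁]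
    have c1 : (t * f₀ * t⁻¹) * f₀⁻¹ = f₀⁻¹ * (t * f₀ * t⁻¹) := by
      have := hA _ hlay_x _ hlay_f
      calc (t * f₀ * t⁻¹) * f₀⁻¹ = f₀⁻¹ * (f₀ * (t * f₀ * t⁻¹)) * f₀⁻¹ := by group
        _ = f₀⁻¹ * ((t * f₀ * t⁻¹) * f₀) * f₀⁻¹ := by rw [this]
        _ = f₀⁻¹ * (t * f₀ * t⁻¹) := by group
    have c2 : (t * f₀ * t⁻¹) * e₀ = e₀ * (t * f₀ * t⁻¹) := hA _ hlay_x _ hlay_e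
    have c3 : f₀⁻¹ * e₀ = e₀ * f₀⁻¹ := hef.inv_right.symm.eq
    calc h₁ * h₁ = (t * f₀ * t⁻¹) * f₀⁻¹ * e₀ * ((t * f₀ * t⁻¹) * f₀⁻¹ * e₀) := by rw [h1]
      _ = (t * f₀ * t⁻¹) * f₀⁻¹ * (e₀ * (t * f₀ * t⁻¹)) * f₀⁻¹ * e₀ := by group
      _ = (t * f₀ * t⁻¹) * f₀⁻¹ * ((t * f₀ * t⁻¹) * e₀) * f₀⁻¹ * e₀ := by rw [c2]
      _ = (t * f₀ * t⁻¹) * (f₀⁻¹ * (t * f₀ * t⁻¹)) * (e₀ * f₀⁻¹) * e₀ := by group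
      _ = (t * f₀ * t⁻¹) * ((t * f₀ * t⁻¹) * f₀⁻¹) * (f₀⁻¹ * e₀) * e₀ := by rw [← c1, ← c3]
      _ = ((t * f₀ * t⁻¹) * (t * f₀ * t⁻¹)) * (f₀ * f₀)⁻¹ * (e₀ * e₀) := by group
      _ = 1 := by rw [hx2, hf2, he2]; group
  obtain ⟨a, b, c, z, hz, rfl⟩ := SL2CentralExtension.exists_decomp he₀ hf₀ hh₁ ht hl he hx
  have hz2 : z * z = 1 := by rw [← pow_two]; exact hK2 z hz
  have hsq : ∀ (v : E) (n : ℕ), v * v = 1 → v ^ n * v ^ n = 1 := by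
    intro v n hv; rw [← pow_add, ← two_mul, pow_mul, pow_two, hv, one_pow]
  have cEH : Commute (e₀ ^ b) (h₁ ^ a) := heh.pow_pow b a
  have cEF : Commute (e₀ ^ b) (f₀ ^ c) := hef.pow_pow b c
  have cHF : Commute (h₁ ^ a) (f₀ ^ c) := hfh.symm.pow_pow a c
  have cz : ∀ w : E, Commute z w := fun w ↦ (hcen z hz w).symm
  calc e₀ ^ b * h₁ ^ a * f₀ ^ c * z * (e₀ ^ b * h₁ ^ a * f₀ ^ c * z)
      = (e₀ ^ b * e₀ ^ b) * (h₁ ^ a * h₁ ^ a) * (f₀ ^ c * f₀ ^ c) * (z * z) := by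
        have h1 := (cz (e₀ ^ b * h₁ ^ a * f₀ ^ c)).eq
        have h2 := cHF.eq; have h3 := cEF.eq; have h4 := cEH.eq
        calc e₀ ^ b * h₁ ^ a * f₀ ^ c * z * (e₀ ^ b * h₁ ^ a * f₀ ^ c * z)
            = e₀ ^ b * h₁ ^ a * f₀ ^ c * (z * (e₀ ^ b * h₁ ^ a * f₀ ^ c)) * z := by group
          _ = e₀ ^ b * h₁ ^ a * f₀ ^ c * ((e₀ ^ b * h₁ ^ a * f₀ ^ c) * z) * z := by rw [h1]
          _ = e₀ ^ b * h₁ ^ a * (f₀ ^ c * e₀ ^ b) * h₁ ^ a * f₀ ^ c * (z * z) := by group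
          _ = e₀ ^ b * h₁ ^ a * (e₀ ^ b * f₀ ^ c) * h₁ ^ a * f₀ ^ c * (z * z) := by rw [h3]
          _ = e₀ ^ b * (h₁ ^ a * e₀ ^ b) * (f₀ ^ c * h₁ ^ a) * f₀ ^ c * (z * z) := by group
          _ = e₀ ^ b * (e₀ ^ b * h₁ ^ a) * (h₁ ^ a * f₀ ^ c) * f₀ ^ c * (z * z) := by rw [← h4, h2]
          _ = (e₀ ^ b * e₀ ^ b) * (h₁ ^ a * h₁ ^ a) * (f₀ ^ c * f₀ ^ c) * (z * z) := by group
    _ = 1 := by rw [hsq e₀ b he2, hsq h₁ a hh2, hsq f₀ c hf2, hz2]; group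

end levelEight

end SL2Mod8

end Literature.GroupTheory.ArithmeticGroups
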